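import Literature.Probability.Process.BrownianVec
import Literature.Probability.Process.BrownianPair
import HarnessLib

/-!
# A model of four-dimensional Brownian motion: two independent Wiener pairs

Topic `Probability/Process`. The hypothesis structure `IsBrownianVec` of `BrownianVec`
(`d`-dimensional Brownian motion: weak Markov property at deterministic times and Gaussian
marginals) is realised for `d = 4` on the product `WienerQuad = WienerPair × WienerPair` of two
copies of the tree's space of pairs of independent canonical Brownian motions (`BrownianPair`:
`wienerPair = preWienerMeasure ⊗ preWienerMeasure`, `pairShift`, `pairPast`, `pairPath`, the weak
Markov property `indepFun_pairShift_pairPast` and the law identities `map_pairShift_wienerPair`,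
`map_pairPath_wienerPair`), with the measure `wienerQuad = wienerPair ⊗ wienerPair`:

* `brownianQuad t ω = (B_t(ω₁₁), B_t(ω₁₂), B_t(ω₂₁), B_t(ω₂₂))`;
* `isBrownianVec_brownianQuad : IsBrownianVec brownianQuad wienerQuad`.

(The first coordinate and the Euclidean norm of the last three give the Brownian excursion
`X + i|W|` of [LSW] §4 in the sibling files.) Everything is proved; no named fact.

## References

* J.-F. Le Gall, *Brownian Motion, Martingales, and Stochastic Calculus*, GTM 274 (2016), Ch. 2
  (the canonical construction; simple Markov property). [Legall2016]
* O. Kallenberg, *Foundations of Modern Probability* (2002), Lemma 3.10 (independence across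
  product spaces), Thm. 13.5. [folklore]
-/

noncomputable section

open MeasureTheory ProbabilityTheory Filter Topology Set Finset
open scoped NNReal ENNReal BigOperators

namespace Literature.Probability.Process

/-- The product of two Wiener pairs: four canonical path spaces. [folklore] -/
abbrev WienerQuad : Type := WienerPair × WienerPair

/-- The law of four independent standard Brownian motions (raw-path coordinates). [folklore] -/
def wienerQuad : Measure WienerQuad := wienerPair.prod wienerPair

/-- `wienerQuad` is a probability measure. [folklore] -/
instance isProbabilityMeasure_wienerQuad : IsProbabilityMeasure wienerQuad := by
  unfold wienerQuad; infer_instance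

/-- The four raw coordinates of a sample. [folklore] -/
def quadCoord (i : Fin 4) (ω : WienerQuad) : ℝ≥0 → ℝ := ![ω.1.1, ω.1.2, ω.2.1, ω.2.2] i

/-- **Four-dimensional Brownian motion** on `WienerQuad`: the continuous Brownian paths
(`brownian`) of the four coordinates. [folklore] -/
def brownianQuad (t : ℝ≥0) (ω : WienerQuad) : Fin 4 → ℝ := fun i ↦ brownian t (quadCoord i ω)

/-- Assembling four paths into one `ℝ⁴`-valued path. [folklore] -/
def quadAssemble {ι : Type*} (p : ((ι → ℝ) × (ι → ℝ)) × ((ι → ℝ) × (ι → ℝ))) : ι → Fin 4 → ℝ :=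
  fun u ↦ ![p.1.1 u, p.1.2 u, p.2.1 u, p.2.2 u]

/-- Each coordinate map is measurable. [folklore] -/
theorem measurable_quadCoord (i : Fin 4) : Measurable (quadCoord i) := by
  fin_cases i
  exacts [measurable_fst.comp measurable_fst, measurable_snd.comp measurable_fst,
    measurable_fst.comp measurable_snd, measurable_snd.comp measurable_snd]

/-- The assembling map is measurable. [folklore] -/
theorem measurable_quadAssemble {ι : Type*} :
    Measurable (quadAssemble : ((ι → ℝ) × (ι → ℝ)) × ((ι → ℝ) × (ι → ℝ)) → ι → Fin 4 → ℝ) := by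
  refine measurable_pi_lambda _ fun u ↦ measurable_pi_lambda _ fun i ↦ ?_
  fin_cases i <;> simp [quadAssemble] <;> fun_prop

/-- The vector path is the assembled pair of pairs of paths. [folklore] -/
theorem vecPath_brownianQuad : vecPath brownianQuad = quadAssemble ∘ Prod.map pairPath pairPath := by
  funext ω u i
  fin_cases i <;> rfl

/-- The shifted vector path is the assembled pair of shifted pairs. [folklore] -/
theorem vecShift_brownianQuad (s : ℝ≥0) :
    vecShift brownianQuad s = quadAssemble ∘ Prod.map (pairShift s) (pairShift s) := by
  funext ω u i
  fin_cases i <;> rfl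

/-- The past of the vector path is the assembled pair of pasts. [folklore] -/
theorem vecPast_brownianQuad (s : ℝ≥0) :
    vecPast brownianQuad s = quadAssemble ∘ Prod.map (pairPast s) (pairPast s) := by
  funext ω u i
  fin_cases i <;> rfl

/-- The marginals of `brownianQuad` are measurable. [folklore] -/
theorem measurable_brownianQuad (t : ℝ≥0) : Measurable (brownianQuad t) :=
  measurable_pi_lambda _ fun i ↦ (measurable_brownian t).comp (measurable_quadCoord i)

/-- **The one-time marginal of `brownianQuad` is `N(0, t I₄)`.** [folklore] -/
theorem map_brownianQuad (t : ℝ≥0) : wienerQuad.map (brownianQuad t) = gaussVec 4 t := by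
  haveI := RandomPlanarGeometry.isProbabilityMeasure_preWienerMeasure'
  symm
  refine Measure.pi_eq fun s hs ↦ ?_
  rw [Measure.map_apply (measurable_brownianQuad t) (MeasurableSet.univ_pi hs)]
  -- the preimage is a product of products
  set A : Fin 4 → Set (ℝ≥0 → ℝ) := fun i ↦ brownian t ⁻¹' s i with hA
  have hpre : brownianQuad t ⁻¹' Set.pi univ s = (A 0 ×ˢ A 1) ×ˢ (A 2 ×ˢ A 3) := by
    ext ω
    simp only [Set.mem_preimage, Set.mem_univ_pi, Set.mem_prod, hA, brownianQuad]
    constructor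
    · intro h
      exact ⟨⟨h 0, h 1⟩, h 2, h 3⟩
    · rintro ⟨⟨h0, h1⟩, h2, h3⟩ i
      fin_cases i
      exacts [h0, h1, h2, h3]
  have hlaw : ∀ i, preWienerMeasure (A i) = gaussianReal 0 t (s i) := fun i ↦ by
    rw [hA, ← Measure.map_apply (measurable_brownian t) (hs i),
      (RandomPlanarGeometry.isPreBrownianReal_brownian.hasLaw_eval t).map_eq]
  rw [hpre, wienerQuad, Measure.prod_prod, wienerPair, Measure.prod_prod, Measure.prod_prod, hlaw, hlaw,
    hlaw, hlaw, Fin.prod_univ_four]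
  ring

/-- **Four independent canonical Brownian motions form a four-dimensional Brownian motion** in
the sense of `IsBrownianVec`. [cite: Legall2016, Ch. 2 (simple Markov property of Brownian motion)] -/
theorem isBrownianVec_brownianQuad : IsBrownianVec brownianQuad wienerQuad where
  measurable := measurable_brownianQuad
  continuous_path ω := continuous_pi fun i ↦ continuous_brownian _
  apply_zero ω := by
    funext i
    simp [brownianQuad, brownian_zero]
  indep_shift s := by
    rw [vecShift_brownianQuad, vecPast_brownianQuad, wienerQuad]
    exact (indepFun_prodMap (indepFun_pairShift_pairPast s) (indepFun_pairShift_pairPast s)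
      (measurable_pairShift s) (measurable_pairPast s) (measurable_pairShift s)
      (measurable_pairPast s)).comp measurable_quadAssemble measurable_quadAssemble
  map_shift s := by
    rw [vecShift_brownianQuad, vecPath_brownianQuad, wienerQuad,
      ← Measure.map_map measurable_quadAssemble ((measurable_pairShift s).prodMap (measurable_pairShift s)),
      ← Measure.map_map measurable_quadAssemble (measurable_pairPath.prodMap measurable_pairPath),
      ← Measure.map_prod_map _ _ (measurable_pairShift s) (measurable_pairShift s),
      ← Measure.map_prod_map _ _ measurable_pairPath measurable_pairPath,
      map_pairShift_wienerPair, map_pairPath_wienerPair]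
  map_apply := map_brownianQuad

end Literature.Probability.Process

end
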